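import Literature.AnabelianGeometry.AbsoluteAnabelian.NeukirchUchidaSeparationOracle
import Literature.NumberTheory.GaloisRepresentations.NeukirchContainmentRat
import HarnessLib

/-!
# The Neukirch–Uchida theorem — `NeukirchUchida F` for every number field `F`

J. Neukirch, A. Schmidt, K. Wingberg, *Cohomology of Number Fields* (2nd ed.), Thm. (12.2.1)
(Neukirch–Uchida; Mochizuki [AbsAnab] Thm 1.1.3): every isomorphism of topological groups between
open subgroups of the absolute Galois group `G_F` of a number field `F` is induced by a unique inner
automorphism, i.e. extends to a field automorphism of `F̄`.

This file is the APEX of the sub-DAG `plan/L4/SUBDAG-NeukirchUchida.md` of the abc-iut cell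
(GAP-LEDGER row G-L4d2g4-1, row «G-L4d2g4-1-NU-DEDUCTION», holder abc-iut-L4-d2): the tree's named
fact `Literature.NumberTheory.GaloisRepresentations.NeukirchUchida` (abc-iut-w5-d201, p437013) is
DISCHARGED for every number field `F : Type`, with ZERO named-fact hypotheses:

* `neukirchUchida_holds F : NeukirchUchida F` :=
  `neukirchUchida_of_rows` (rows R1, R6–R12; abc-iut-L4-d2 / w6-d055 / w6-d108 / w5-d047 / w5-d201)
  ∘ (12.1.9) at base `ℚ` in containment form
    (`ExplicitMuCocycles.exists_map_stabilizer_subgroupOf_le`, `…exists_map_symm_stabilizer_subgroupOf_le`,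
    abc-iut-w5-d055 with abc-iut-w6-d070's binders)
  ∘ the degree / degree-one transfer `hdeg_hP₁_of_containment` (rows R2–R5, abc-iut-w6-d108 /
    w5-d116 / w5-d201)
  ∘ the separation oracle `separation_oracle` (rows R8–R10b, abc-iut-L4-d2 / w5-d047).

HONEST FRAMING: classical algebraic number theory (outside the [IUTchIII] Cor. 3.12 cone); nothing
here takes a side on any disputed inference, and nothing here is an abc claim.

## References
* [NeukirchSchmidtWingberg2008] Neukirch–Schmidt–Wingberg, *Cohomology of Number Fields*, (12.1.9), Thm (12.2.1).
* [MochizukiAbsAnab2004] S. Mochizuki, *The absolute anabelian geometry of hyperbolic curves*, Thm 1.1.3.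
* [NeukirchANT1999] J. Neukirch, *Algebraic Number Theory*, Ch. I §8–§9, Ch. VII §13.
-/

noncomputable section

open scoped Pointwise NumberField
open Field NumberField IsDedekindDomain
open Literature.NumberTheory.GaloisRepresentations
open Literature.NumberTheory.GaloisRepresentations.NeukirchUchidaProof

namespace Literature.AnabelianGeometry.AbsoluteAnabelian

namespace NeukirchUchidaProof

/-- **The rows of the `ℚ`-core, discharged from (12.1.9)**: for open `V₁, V₂ ≤ Γ = G_ℚ` and
`β : V₁ ⥲ V₂` with the (12.1.9)-containments for `β` and `β⁻¹`, the `hrows` data of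
`neukirchUchida_of_rows` — a finite Galois level `Γ_N ≤ V₁` (`exists_isGalois_subset_ΓK_le`), the
degree and degree-one transfer at `Γ_N` (`hdeg_hP₁_of_containment`), and the separation oracle
(`separation_oracle`). [cite: NeukirchSchmidtWingberg2008, Thm (12.2.1)] -/
theorem hrows_of_containment (V₁ V₂ : Subgroup (absoluteGaloisGroup ℚ))
    (hV₁ : IsOpen (V₁ : Set (absoluteGaloisGroup ℚ))) (hV₂ : IsOpen (V₂ : Set (absoluteGaloisGroup ℚ)))
    (β : V₁ ≃ₜ* V₂)
    (hβ : ∀ A : ValuationSubring (AlgebraicClosure ℚ), A ≠ ⊤ →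
      ∃ B : ValuationSubring (AlgebraicClosure ℚ), B ≠ ⊤ ∧
        ((MulAction.stabilizer (absoluteGaloisGroup ℚ) A).subgroupOf V₁).map β.toMulEquiv.toMonoidHom ≤
          (MulAction.stabilizer (absoluteGaloisGroup ℚ) B).subgroupOf V₂)
    (hβ' : ∀ B : ValuationSubring (AlgebraicClosure ℚ), B ≠ ⊤ →
      ∃ A : ValuationSubring (AlgebraicClosure ℚ), A ≠ ⊤ ∧
        ((MulAction.stabilizer (absoluteGaloisGroup ℚ) B).subgroupOf V₂).map
            β.toMulEquiv.symm.toMonoidHom ≤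
          (MulAction.stabilizer (absoluteGaloisGroup ℚ) A).subgroupOf V₁) :
    ∃ (N : IntermediateField ℚ (AlgebraicClosure ℚ)) (_ : FiniteDimensional ℚ N) (_ : IsGalois ℚ N)
      (hNV : ΓK N ≤ V₁),
      Module.finrank ℚ (KV (ΓK N)) = Module.finrank ℚ
        (KV ((((ΓK N).subgroupOf V₁).map β.toMulEquiv.toMonoidHom).map V₂.subtype)) ∧
      (∀ v₀ : HeightOneSpectrum (𝓞 ℚ),
        (∃ P' ∈ v₀.asIdeal.primesOver
            (𝓞 (KV ((((ΓK N).subgroupOf V₁).map β.toMulEquiv.toMonoidHom).map V₂.subtype))),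
            P'.ramificationIdx (𝓞 ℚ) = 1 ∧ P'.inertiaDeg (𝓞 ℚ) = 1) →
          ∃ P ∈ v₀.asIdeal.primesOver (𝓞 (KV (ΓK N))),
            P.ramificationIdx (𝓞 ℚ) = 1 ∧ P.inertiaDeg (𝓞 ℚ) = 1) ∧
      (∀ M : IntermediateField ℚ (AlgebraicClosure ℚ), FiniteDimensional ℚ M → IsGalois ℚ M →
        N ≤ M → ∃ (A₀ : ValuationSubring (AlgebraicClosure ℚ)) (m₀ m₁ : absoluteGaloisGroup ℚ),
          ((MulAction.stabilizer (absoluteGaloisGroup ℚ) A₀).subgroupOf V₁).map β.toMulEquiv.toMonoidHom =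
            (MulAction.stabilizer (absoluteGaloisGroup ℚ) (m₀ • A₀)).subgroupOf V₂ ∧
          ∀ (a : absoluteGaloisGroup ℚ) (_ : a ∈ ΓK N) (m : absoluteGaloisGroup ℚ),
            (∀ (g : absoluteGaloisGroup ℚ) (hg : g ∈ ΓK N),
              g ∈ MulAction.stabilizer (absoluteGaloisGroup ℚ) (a • A₀) ↔
                ((β ⟨g, hNV hg⟩ : V₂) : absoluteGaloisGroup ℚ) ∈
                  MulAction.stabilizer (absoluteGaloisGroup ℚ) (m • a • A₀)) →
            m⁻¹ * m₁ ∈ ΓK M) := by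
  obtain ⟨N, hNfin, hNgal, -, hNV⟩ := exists_isGalois_subset_ΓK_le V₁ hV₁ ∅ Set.finite_empty
  haveI := hNfin
  haveI := hNgal
  obtain ⟨hdeg, hP₁⟩ := hdeg_hP₁_of_containment hV₁ hV₂ β hβ hβ' (ΓK N) (isOpen_ΓK N) hNV
  exact ⟨N, hNfin, hNgal, hNV, hdeg, hP₁,
    fun M hMfin hMgal hNM => separation_oracle hV₁ hV₂ β hβ hβ' N hNV M hMfin hMgal hNM⟩

end NeukirchUchidaProof

open NeukirchUchidaProof

/-- **The Neukirch–Uchida theorem** ([NSW] Thm. (12.2.1); [AbsAnab] Thm 1.1.3): for every number field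
`F`, every pair of open subgroups `U₁, U₂ ≤ G_F = Gal(F̄/F)` and every isomorphism of topological
groups `α : U₁ ⥲ U₂`, there is a field automorphism `τ` of `F̄` with `α(u) ∘ τ = τ ∘ u` for all
`u ∈ U₁` — the tree's named fact `NeukirchUchida F`, now a THEOREM (zero named-fact hypotheses):
(12.1.9) at base `ℚ` (`ExplicitMuCocycles.exists_map_stabilizer_subgroupOf_le` and its `β⁻¹`-form),
the `ℚ`-core `neukirchUchida_of_rows` with its rows discharged (`hrows_of_containment`), and the
transport to `F` (`neukirchUchida_of_ratCore`, inside `neukirchUchida_of_rows`).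
[cite: NeukirchSchmidtWingberg2008, Thm (12.2.1)] [cite: MochizukiAbsAnab2004, Thm 1.1.3 p.6] -/
theorem neukirchUchida_holds (F : Type) [Field F] [NumberField F] :
    Literature.NumberTheory.GaloisRepresentations.NeukirchUchida F :=
  neukirchUchida_of_rows
    (fun _ _ hV₁ _ β A hA => ExplicitMuCocycles.exists_map_stabilizer_subgroupOf_le hV₁ β A hA)
    (fun V₁ V₂ hV₁ hV₂ β hβ hβ' => hrows_of_containment V₁ V₂ hV₁ hV₂ β hβ hβ') F

end Literature.AnabelianGeometry.AbsoluteAnabelian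

end
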